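import Mathlib
import Literature.MathematicalPhysics.QuantumFieldTheory.Balaban1983to89.Beta.TorusG0GradDecay

/-!
# Beta / TorusG0DivDecay — the `H⁻¹`-source members `G₀∇^{η*}` and `∇^η G₀ ∇^{η*}` of
`G₀ = (−Δ^η + a Q*Q)⁻¹` on the torus type: `η`-uniform `L²` bounds and set-to-set decay

HONEST FRAMING (verbatim, page 1 of everything this cell writes): discharging `BetaPertH` makes Bałaban's UV
stability UNCONDITIONAL — a real constructive-QFT result; it is NOT the continuum limit and NOT the Clay problem.
Gloss (BETA-SPEC v1.9b l. 17–18, G-ref2-14 (a) / G-ref2-20 (a), verbatim): «UNCONDITIONAL» in [Balaban1989LargeFieldII]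
(B16, CMP 122) p. 355's interval-hypothesis sense ONLY (`FlowStepRuns.p355Unconditional_of_partialSums` keeps `hnodes`);
the located leaves G-adv3-2 (left inequality of (0.1)/(2.50), d = 4), G-adv3-1 (U2 transfer of B14 Cor. 3's lower
bound) and `SecondExpLeaf` REMAIN.  Gloss 2 (BETA-SPEC v1.9e 22:38Z, beta-ref C-beta-78, BINDING, verbatim): «UNCONDITIONAL» =
`Beta.Assembly.EventualForm`-unconditional — the END statement with the interval hypothesis removed, (0.31) in DEFECTED form
on all lattices (`PrefixAbsorption.thm2Defected_of_eventualForm`), admissible couplings shrunk to g ≤ g⋆; NOT «B12 Theorem 2 as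
printed» (that needs (AF-0s) or (AF-0-L) ∀k at L ≥ L₁ in addition: `eventualForm_not_thm2Printed`, RULING (R6)); never the
continuum limit / mass gap / Clay.  THIS MODULE discharges nothing of that and makes NO UV-stability claim at all: it
is a Mathlib-elementary kernel certificate (v1.0.1/v1.0.2 = v1 + this paragraph, docstring-only — beta-ref R129/R150,
ref2 G-ref2-20 (a); no declaration changed).

SCOPE.  Mathlib-elementary; nothing printed by Bałaban is asserted, no hypothesis is a quotation.  The
siblings give the `L²` set-to-set decay of `G₀` (`TorusG0Decay.setDecay_torus`, `TorusG0Kernel.G0_setDecay`) and of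
its lattice gradient `∇^η G₀` (`TorusG0GradDecay.G0_gradDecay`, constant `32/min(2,a)`), all with the `η`-free rate
`δ` subject to `2dδ² + a(e^δ − 1) ≤ min(2,a)/2`.  THIS MODULE treats sources of DIVERGENCE form
`g = ∇^{η*} f = (n+1) Σ_μ (f_μ(· − e_μ) − f_μ)` — the `H^{−1}`-type right-hand sides — for which `L²` bounds on `G₀g`
in terms of `‖g‖` lose a factor `η⁻¹`, while the correct objects `G₀∇^{η*}` and `∇^η G₀ ∇^{η*}` are bounded
UNIFORMLY in `η`:

* §1 GENERIC (finite index type): `conj_pairing_identity` (`⟨w,Hw⟩ + defect(w) = Σ_j w_j e^{φ_j}(Hv)_j`, `w = e^{φ}v`);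
  `energy_le_of_pairing` (if the pairing is `≤ ¼⟨w,Hw⟩ + K`, the defect is `≥ −(σ/2)‖w‖²` and `σ‖ω‖² ≤ ⟨ω,Hω⟩`,
  then `⟨w,Hw⟩ ≤ 4K`); the pure bond algebra `weightedGradSq_le_energy`
  (`Σ_{j,k} c_jk (e^{φ_j}(v_j − v_k))² ≤ 2 Σ c_jk (w_j − w_k)² + 2ε²ρ‖w‖²`) and `setGradSq_le_weighted`; and
  `defect_ge_lattice_dist`, the conjugation-defect bound of the siblings for the weight `δ·dist(·,T)` in the
  lattice shape, extracted as a lemma.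
* §2 TORUS CALCULUS on `T_η = Tor (fine (n+1) M)`: `grad` (`(∇^η_μ w)(x) = (n+1)(w(x+e_μ) − w(x))`), `dive`
  (`∇^{η*} f`) — the real-valued counterparts, with the same sign and scaling conventions (`c = n+1`), of the
  complex matrix-form `B5Action121.sdiff` / `divS` of another lineage (no bridge lemma is proved here) —
  `sum_shift`, `dive_adjoint` (summation by parts `⟨w, ∇^{η*}f⟩ = Σ_μ ⟨f_μ, ∇^η_μ w⟩`),
  `gradSq_le_two_form` (`Σ_μ ‖∇^η_μ w‖² ≤ 2⟨w, Hw⟩`, `H = torusOp n M a`), `dotProduct_G0_mulVec_comm`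
  (`G₀` symmetric), the weight `twt = δ·dist_e(·,T)` (`= 0` on `T`, `δη`-Lipschitz across bonds) and
  `torusOp_defect_ge` (defect `≥ −(2dδ² + a(e^δ − 1))‖w‖²`).
* §3 **`G0_dive_setDecay`** (periods `≥ 3`, `a > 0`, `0 ≤ δ ≤ 1`, `2dδ² + a(e^δ − 1) ≤ min(2,a)/2`): for `f`
  supported in `T` and `edist(S,T) ≥ R`, `Σ_{x∈S} (G₀∇^{η*}f)(x)² ≤ (32/min(2,a)) e^{−2δR} Σ_μ Σ_x f_μ(x)²` — by
  DUALITY (`G₀ᵀ = G₀`, `dive_adjoint`) from the sibling's gradient decay; corollary **`G0_dive_sq_le`**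
  (`δ = 0`): `‖G₀∇^{η*}f‖² ≤ (32/min(2,a)) ‖f‖²` for every `f`, uniformly in `η`.
* §4 **`G0_dive_energy`**: for `w = e^{twt} G₀∇^{η*}f`, `⟨w, Hw⟩ ≤ 24 Σ_μΣ_x f_μ(x)²` (weighted summation by
  parts: on `T` the weight is `1`, across a bond it moves by `≤ 2δη`, so the pairing is
  `≤ ‖f‖(‖∇^η w‖_{T} + 2δ‖w(·+e)‖_{T}) ≤ ¼⟨w,Hw⟩ + 6‖f‖²` by AM–GM, `4dδ² ≤ min(2,a)` and coercivity).
* §5 **`G0_dive_gradDecay`**: `u = G₀∇^{η*}f`, `f` supported in `T`, `edist(S,T) ≥ R` ⇒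
  `Σ_{x∈S} (n+1)² Σ_μ [(u(x) − u(x+e_μ))² + (u(x) − u(x−e_μ))²] ≤ 192 · e^{−2δR} · Σ_μ Σ_x f_μ(x)²` — the
  `η`-uniform set-to-set decay of `∇^η G₀ ∇^{η*}`, with a constant that (given the smallness condition) does not
  even depend on `a`; corollary **`G0_dive_grad_sq_le`** (`δ = 0`): `Σ_x (n+1)² Σ_μ[…] ≤ 192 ‖f‖²`, i.e.
  `∇^η G₀ ∇^{η*}` is `ℓ²`-bounded uniformly in the mesh.

WHAT IT DOES NOT GIVE.  (i) same-side second differences `∇^η∇^η G₀` (discrete elliptic regularity — not a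
conjugation argument); (ii) covariant (`U ≠ 1`) Laplacians and the non-local members of Bałaban's class `𝒦_k`;
(iii) any short-distance gain; (iv) periods `≤ 2`.  B5 = T. Bałaban, Commun. Math. Phys. 95 (1984) 17–40
[Balaban1984PropagatorsI] is CONTEXT only ((1.18) p. 20).  Device reference: Combes–Thomas [CombesThomas1973, §II]
via the imported modules.  Unit `b2b-balaban-pv23-g3` (surge node prover #23, gen 3; journal claim
BETA-TORUS-G0-DIV-DECAY); census C-pv23g3-12 (GAPS.md); staged byte-identically under `HOME/lean/BalabanYm4/`.
Value = kernel certificate, NOT summit progress.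
-/

open Finset Matrix

namespace Literature.MathematicalPhysics.QuantumFieldTheory.Balaban1983to89.Beta.TorusG0DivDecay

open B5Prop11Plancherel (Tor fine unitVec)
open CombesThomasForm (lap lap_apply lap_mulVec lap_form lapDefect_le blockDefect_le)
open CombesThomasFormOp (conjError_lap_add_blocks_ge distTo distTo_le le_distTo distTo_le_zero_of_mem
  abs_distTo_sub_le)
open TorusG0Decay (torusOp coupling coupling_symm coupling_nonneg coupling_bond adj_of_coupling_ne_zero
  card_coupling_ne_zero_le coercive_torus edist ldist ldist_self ldist_symm ldist_triangle ldist_le_one_of_adj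
  ldist_le_of_same_block sum_blockInd_sq card_block_ne_zero)
open TorusG0Kernel (G0 torusOp_mulVec_G0 G0_transpose)
open TorusG0GradDecay (gradSq_le_form rowSum_le sum_coupling_mul G0_gradDecay)

noncomputable section

/-! ## §1  Generic: the pairing identity, energy from a pairing bound, bond algebra, the lattice defect -/

section Generic

variable {ι : Type*} [Fintype ι]

/-- **the conjugation/pairing identity**: for `w = e^{φ} v`,
`⟨w, Hw⟩ + Σ_{j,k} (e^{φ_j−φ_k} − 1) H_jk w_j w_k = Σ_j w_j e^{φ_j} (Hv)_j`. [cite: CombesThomas1973, §II] [folklore] -/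
theorem conj_pairing_identity (H : Matrix ι ι ℝ) (φ v : ι → ℝ) :
    (fun j => Real.exp (φ j) * v j) ⬝ᵥ H.mulVec (fun j => Real.exp (φ j) * v j)
      + ∑ j, ∑ k, (Real.exp (φ j - φ k) - 1) * H j k * ((Real.exp (φ j) * v j) * (Real.exp (φ k) * v k))
      = ∑ j, (Real.exp (φ j) * v j) * (Real.exp (φ j) * H.mulVec v j) := by
  simp only [dotProduct, mulVec, Finset.mul_sum, ← Finset.sum_add_distrib]
  refine Finset.sum_congr rfl fun j _ => Finset.sum_congr rfl fun k _ => ?_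
  rw [Real.exp_sub]
  field_simp
  ring

/-- **energy from a pairing bound.**  If `σ‖ω‖² ≤ ⟨ω,Hω⟩`, the conjugation defect of `φ` is `≥ −(σ/2)‖w‖²`, and
for `w = e^{φ}v` the pairing `Σ_j w_j e^{φ_j}(Hv)_j` is `≤ ¼⟨w,Hw⟩ + K`, then `⟨w,Hw⟩ ≤ 4K`
(`⟨w,Hw⟩ = pairing − defect ≤ ¼⟨w,Hw⟩ + K + ½⟨w,Hw⟩`). [cite: CombesThomas1973, §II] [folklore] -/
theorem energy_le_of_pairing (H : Matrix ι ι ℝ) (σ : ℝ) (φ : ι → ℝ)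
    (hpos : ∀ ω : ι → ℝ, σ * (ω ⬝ᵥ ω) ≤ ω ⬝ᵥ H.mulVec ω)
    (herr : ∀ w : ι → ℝ,
      -(σ / 2) * (w ⬝ᵥ w) ≤ ∑ j, ∑ k, (Real.exp (φ j - φ k) - 1) * H j k * (w j * w k))
    (v : ι → ℝ) (K : ℝ)
    (hpair : ∑ j, (Real.exp (φ j) * v j) * (Real.exp (φ j) * H.mulVec v j)
      ≤ 1 / 4 * ((fun j => Real.exp (φ j) * v j) ⬝ᵥ H.mulVec (fun j => Real.exp (φ j) * v j)) + K) :
    (fun j => Real.exp (φ j) * v j) ⬝ᵥ H.mulVec (fun j => Real.exp (φ j) * v j) ≤ 4 * K := by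
  have hid := conj_pairing_identity H φ v
  have hd : -(σ / 2) * ((fun j => Real.exp (φ j) * v j) ⬝ᵥ (fun j => Real.exp (φ j) * v j))
      ≤ ∑ j, ∑ k, (Real.exp (φ j - φ k) - 1) * H j k * ((Real.exp (φ j) * v j) * (Real.exp (φ k) * v k)) :=
    herr (fun j => Real.exp (φ j) * v j)
  have hc := hpos (fun j => Real.exp (φ j) * v j)
  linarith

/-- **pure bond algebra**: `c ≥ 0`, `|e^{φ_j−φ_k} − 1| ≤ ε` across bonds, column sums `≤ ρ`; then with `w = e^{φ}v`,
`Σ_{j,k} c_jk (e^{φ_j}(v_j − v_k))² ≤ 2 Σ_{j,k} c_jk (w_j − w_k)² + 2ε²ρ Σ_k w_k²`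
(`e^{φ_j}(v_j − v_k) = (w_j − w_k) − (e^{φ_j−φ_k} − 1) w_k` and `(X − Y)² ≤ 2X² + 2Y²`). [folklore] -/
theorem weightedGradSq_le_energy (c : ι → ι → ℝ) (hc0 : ∀ j k, 0 ≤ c j k) (φ v : ι → ℝ) {ε ρ : ℝ}
    (hε : ∀ j k, c j k ≠ 0 → |Real.exp (φ j - φ k) - 1| ≤ ε) (hρ : ∀ k, ∑ j, c j k ≤ ρ) :
    ∑ j, ∑ k, c j k * (Real.exp (φ j) * (v j - v k)) ^ 2
      ≤ 2 * ∑ j, ∑ k, c j k * (Real.exp (φ j) * v j - Real.exp (φ k) * v k) ^ 2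
        + 2 * ε ^ 2 * (ρ * ∑ k, (Real.exp (φ k) * v k) ^ 2) := by
  have hXY : ∀ X Y : ℝ, (X - Y) ^ 2 ≤ 2 * X ^ 2 + 2 * Y ^ 2 := fun X Y => by nlinarith [sq_nonneg (X + Y)]
  have hterm : ∀ j k, c j k * (Real.exp (φ j) * (v j - v k)) ^ 2 ≤
      2 * (c j k * (Real.exp (φ j) * v j - Real.exp (φ k) * v k) ^ 2)
        + 2 * ε ^ 2 * (c j k * (Real.exp (φ k) * v k) ^ 2) := by
    intro j k
    by_cases hjk : c j k = 0
    · simp [hjk]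
    · have hid : Real.exp (φ j) * (v j - v k) =
          (Real.exp (φ j) * v j - Real.exp (φ k) * v k) - (Real.exp (φ j - φ k) - 1) * (Real.exp (φ k) * v k) := by
        rw [Real.exp_sub]
        field_simp
        ring
      have hb := abs_le.mp (hε j k hjk)
      have hY : ((Real.exp (φ j - φ k) - 1) * (Real.exp (φ k) * v k)) ^ 2 ≤ ε ^ 2 * (Real.exp (φ k) * v k) ^ 2 := by
        rw [mul_pow]
        exact mul_le_mul_of_nonneg_right (sq_le_sq' hb.1 hb.2) (sq_nonneg _)
      rw [hid]
      calc c j k * ((Real.exp (φ j) * v j - Real.exp (φ k) * v k)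
              - (Real.exp (φ j - φ k) - 1) * (Real.exp (φ k) * v k)) ^ 2
          ≤ c j k * (2 * (Real.exp (φ j) * v j - Real.exp (φ k) * v k) ^ 2
              + 2 * ((Real.exp (φ j - φ k) - 1) * (Real.exp (φ k) * v k)) ^ 2) :=
            mul_le_mul_of_nonneg_left (hXY _ _) (hc0 j k)
        _ ≤ c j k * (2 * (Real.exp (φ j) * v j - Real.exp (φ k) * v k) ^ 2
              + 2 * (ε ^ 2 * (Real.exp (φ k) * v k) ^ 2)) :=
            mul_le_mul_of_nonneg_left (by linarith [hY]) (hc0 j k)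
        _ = 2 * (c j k * (Real.exp (φ j) * v j - Real.exp (φ k) * v k) ^ 2)
              + 2 * ε ^ 2 * (c j k * (Real.exp (φ k) * v k) ^ 2) := by ring
  have hsum : ∑ j, ∑ k, c j k * (Real.exp (φ j) * (v j - v k)) ^ 2 ≤
      2 * ∑ j, ∑ k, c j k * (Real.exp (φ j) * v j - Real.exp (φ k) * v k) ^ 2
        + 2 * ε ^ 2 * ∑ j, ∑ k, c j k * (Real.exp (φ k) * v k) ^ 2 := by
    calc ∑ j, ∑ k, c j k * (Real.exp (φ j) * (v j - v k)) ^ 2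
        ≤ ∑ j, ∑ k, (2 * (c j k * (Real.exp (φ j) * v j - Real.exp (φ k) * v k) ^ 2)
            + 2 * ε ^ 2 * (c j k * (Real.exp (φ k) * v k) ^ 2)) :=
          Finset.sum_le_sum fun j _ => Finset.sum_le_sum fun k _ => hterm j k
      _ = 2 * ∑ j, ∑ k, c j k * (Real.exp (φ j) * v j - Real.exp (φ k) * v k) ^ 2
            + 2 * ε ^ 2 * ∑ j, ∑ k, c j k * (Real.exp (φ k) * v k) ^ 2 := by
          simp only [Finset.mul_sum, Finset.sum_add_distrib]
  have hB : ∑ j, ∑ k, c j k * (Real.exp (φ k) * v k) ^ 2 ≤ ρ * ∑ k, (Real.exp (φ k) * v k) ^ 2 := by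
    rw [Finset.sum_comm]
    calc ∑ k, ∑ j, c j k * (Real.exp (φ k) * v k) ^ 2 = ∑ k, (∑ j, c j k) * (Real.exp (φ k) * v k) ^ 2 :=
          Finset.sum_congr rfl fun k _ => by rw [Finset.sum_mul]
      _ ≤ ∑ k, ρ * (Real.exp (φ k) * v k) ^ 2 :=
          Finset.sum_le_sum fun k _ => mul_le_mul_of_nonneg_right (hρ k) (sq_nonneg _)
      _ = ρ * ∑ k, (Real.exp (φ k) * v k) ^ 2 := by rw [← Finset.mul_sum]
  exact hsum.trans (add_le_add le_rfl (mul_le_mul_of_nonneg_left hB (by positivity)))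

/-- restricting to `S` where `lo ≤ φ`: `Σ_{j∈S} Σ_k c_jk (v_j − v_k)² ≤ e^{−2lo} Σ_{j,k} c_jk (e^{φ_j}(v_j − v_k))²`
(`c ≥ 0`). [folklore] -/
theorem setGradSq_le_weighted (c : ι → ι → ℝ) (hc0 : ∀ j k, 0 ≤ c j k) (φ v : ι → ℝ) (S : Finset ι) (lo : ℝ)
    (hlo : ∀ i ∈ S, lo ≤ φ i) :
    ∑ j ∈ S, ∑ k, c j k * (v j - v k) ^ 2
      ≤ Real.exp (-(2 * lo)) * ∑ j, ∑ k, c j k * (Real.exp (φ j) * (v j - v k)) ^ 2 := by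
  calc ∑ j ∈ S, ∑ k, c j k * (v j - v k) ^ 2
      ≤ ∑ j ∈ S, ∑ k, Real.exp (-(2 * lo)) * (c j k * (Real.exp (φ j) * (v j - v k)) ^ 2) := by
        refine Finset.sum_le_sum fun j hj => Finset.sum_le_sum fun k _ => ?_
        have e1 : (1 : ℝ) ≤ Real.exp (-(2 * lo)) * Real.exp (φ j) ^ 2 := by
          rw [← Real.exp_nat_mul, ← Real.exp_add]
          exact Real.one_le_exp (by push_cast; linarith [hlo j hj])
        calc c j k * (v j - v k) ^ 2 = 1 * (c j k * (v j - v k) ^ 2) := (one_mul _).symm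
          _ ≤ (Real.exp (-(2 * lo)) * Real.exp (φ j) ^ 2) * (c j k * (v j - v k) ^ 2) :=
              mul_le_mul_of_nonneg_right e1 (mul_nonneg (hc0 j k) (sq_nonneg _))
          _ = Real.exp (-(2 * lo)) * (c j k * (Real.exp (φ j) * (v j - v k)) ^ 2) := by ring
    _ = Real.exp (-(2 * lo)) * ∑ j ∈ S, ∑ k, c j k * (Real.exp (φ j) * (v j - v k)) ^ 2 := by
        simp only [Finset.mul_sum]
    _ ≤ Real.exp (-(2 * lo)) * ∑ j, ∑ k, c j k * (Real.exp (φ j) * (v j - v k)) ^ 2 := by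
        refine mul_le_mul_of_nonneg_left ?_ (Real.exp_pos _).le
        exact Finset.sum_le_sum_of_subset_of_nonneg (Finset.subset_univ S) fun j _ _ =>
          Finset.sum_nonneg fun k _ => mul_nonneg (hc0 j k) (sq_nonneg _)

/-- **the conjugation defect of the weight `δ·dist(·,T)` in the lattice shape** (extracted from the siblings'
proofs): `H = lap c + Σ_b m_b u_b ⊗ u_b`, bonds of coefficient `η⁻²` and `d`-length `≤ η` on `≤ z` neighbours,
blocks of `d`-diameter `≤ D` with strengths `m_b‖u_b‖² ≤ a`, `0 ≤ δ`, `δη ≤ 1`; then for every `w`,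
`−(zδ² + a(e^{δD} − 1))‖w‖² ≤ Σ_{j,k} (e^{φ_j−φ_k} − 1) H_jk w_j w_k`, `φ = δ·distTo d T`.
[cite: CombesThomas1973, §II] [folklore] -/
theorem defect_ge_lattice_dist [DecidableEq ι] {β : Type*} [Fintype β] [DecidableEq β]
    (c : ι → ι → ℝ) (hcs : ∀ j k, c j k = c k j) (hc0 : ∀ j k, 0 ≤ c j k)
    (blk : ι → β) (m : β → ℝ) (hm : ∀ b, 0 ≤ m b) (u : β → ι → ℝ) (hu : ∀ b j, blk j ≠ b → u b j = 0)
    (H : Matrix ι ι ℝ) (hH : ∀ j k, H j k = lap c j k + ∑ b, m b * (u b j * u b k))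
    (d : ι → ι → ℝ) (hds : ∀ i j, d i j = d j i) (hdt : ∀ i j k, d i k ≤ d i j + d j k)
    {η δ z a D : ℝ} (hη : 0 < η) (hδ : 0 ≤ δ) (h1 : δ * η ≤ 1) (hD : 0 ≤ D)
    (hc : ∀ j k, c j k ≠ 0 → c j k = (η ^ 2)⁻¹ ∧ d j k ≤ η)
    (hz : ∀ j, ((univ.filter fun k => c j k ≠ 0).card : ℝ) ≤ z)
    (hblk : ∀ j k, blk j = blk k → d j k ≤ D)
    (ha : ∀ b, m b * ∑ k, u b k ^ 2 ≤ a)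
    (T : Finset ι) (hT : T.Nonempty) (w : ι → ℝ) :
    -(z * δ ^ 2 + a * (Real.exp (δ * D) - 1)) * (w ⬝ᵥ w)
      ≤ ∑ j, ∑ k, (Real.exp (δ * distTo d T hT j - δ * distTo d T hT k) - 1) * H j k * (w j * w k) := by
  have hlip : ∀ j k, |δ * distTo d T hT j - δ * distTo d T hT k| ≤ δ * d j k := by
    intro j k
    rw [← mul_sub, abs_mul, abs_of_nonneg hδ]
    exact mul_le_mul_of_nonneg_left (abs_distTo_sub_le d hds hdt T hT j k) hδ
  have hε0 : 0 ≤ Real.exp (δ * D) - 1 := by linarith [Real.add_one_le_exp (δ * D), mul_nonneg hδ hD]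
  exact conjError_lap_add_blocks_ge c hcs hc0 blk m hm u hu H hH (fun j => δ * distTo d T hT j) (z * δ ^ 2)
    (a * (Real.exp (δ * D) - 1))
    (lapDefect_le c _ hη h1
      (fun j k hjk => ⟨(hc j k hjk).1, (hlip j k).trans (mul_le_mul_of_nonneg_left (hc j k hjk).2 hδ)⟩) hz)
    (fun _ => Real.exp (δ * D) - 1) (fun _ => hε0)
    (fun b j k hj hk => blockDefect_le blk _ (δ * D)
      (fun j k hjk => (hlip j k).trans (mul_le_mul_of_nonneg_left (hblk j k hjk) hδ)) b j k hj hk)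
    (fun b => by
      calc m b * (Real.exp (δ * D) - 1) * ∑ k, u b k ^ 2 = (Real.exp (δ * D) - 1) * (m b * ∑ k, u b k ^ 2) := by
            ring
        _ ≤ (Real.exp (δ * D) - 1) * a := mul_le_mul_of_nonneg_left (ha b) hε0
        _ = a * (Real.exp (δ * D) - 1) := mul_comm _ _) w

end Generic

/-! ## §2  Torus calculus: gradient, divergence source, summation by parts, the weight -/

section Torus

variable {d : ℕ}

/-- translation invariance of `Σ` over the torus. [folklore] -/
theorem sum_shift (N : Fin d → ℕ) [∀ μ, NeZero (N μ)] (e : Tor N) (F : Tor N → ℝ) :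
    ∑ x, F (x + e) = ∑ x, F x :=
  Fintype.sum_equiv (Equiv.addRight e) _ _ fun _ => rfl

variable (n : ℕ) (M : Fin d → ℕ) [hM : ∀ μ, NeZero (M μ)]

/-- the forward lattice gradient in physical units: `(∇^η_μ w)(x) = (n+1)(w(x+e_μ) − w(x))`, `η = 1/(n+1)`
(real-valued counterpart of `B5Action121.sdiff N c μ`, `c = n+1`). [folklore] -/
def grad (w : Tor (fine (n + 1) M) → ℝ) (μ : Fin d) (x : Tor (fine (n + 1) M)) : ℝ :=
  ((n : ℝ) + 1) * (w (x + unitVec (fine (n + 1) M) μ) - w x)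

/-- the divergence-form source `(∇^{η*} f)(x) = Σ_μ ((∇^η_μ)* f_μ)(x) = (n+1) Σ_μ (f_μ(x − e_μ) − f_μ(x))` of a
family `f = (f_μ)_μ` of bond functions (real-valued counterpart of `B5Action121.divS N c A`, `A (x, μ) = f_μ(x)`,
`c = n+1`). [folklore] -/
def dive (f : Fin d → Tor (fine (n + 1) M) → ℝ) (x : Tor (fine (n + 1) M)) : ℝ :=
  ((n : ℝ) + 1) * ∑ μ, (f μ (x - unitVec (fine (n + 1) M) μ) - f μ x)

/-- **summation by parts**: `⟨w, ∇^{η*}f⟩ = Σ_μ ⟨f_μ, ∇^η_μ w⟩`. [folklore] -/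
theorem dive_adjoint (w : Tor (fine (n + 1) M) → ℝ) (f : Fin d → Tor (fine (n + 1) M) → ℝ) :
    ∑ x, w x * dive n M f x = ∑ μ, ∑ x, f μ x * grad n M w μ x := by
  have key : ∀ μ, ∑ x, w x * (f μ (x - unitVec (fine (n + 1) M) μ) - f μ x) =
      ∑ x, f μ x * (w (x + unitVec (fine (n + 1) M) μ) - w x) := by
    intro μ
    have hs := sum_shift (fine (n + 1) M) (unitVec (fine (n + 1) M) μ)
      (fun x => w x * f μ (x - unitVec (fine (n + 1) M) μ))
    simp only [add_sub_cancel_right] at hs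
    simp only [mul_sub, Finset.sum_sub_distrib, ← hs]
    exact congrArg₂ _ (Finset.sum_congr rfl fun x _ => mul_comm _ _) (Finset.sum_congr rfl fun x _ => mul_comm _ _)
  calc ∑ x, w x * dive n M f x
      = ∑ x, ∑ μ, ((n : ℝ) + 1) * (w x * (f μ (x - unitVec (fine (n + 1) M) μ) - f μ x)) := by
        refine Finset.sum_congr rfl fun x _ => ?_
        simp only [dive, Finset.mul_sum]
        exact Finset.sum_congr rfl fun μ _ => by ring
    _ = ∑ μ, ((n : ℝ) + 1) * ∑ x, w x * (f μ (x - unitVec (fine (n + 1) M) μ) - f μ x) := by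
        rw [Finset.sum_comm]; simp only [Finset.mul_sum]
    _ = ∑ μ, ((n : ℝ) + 1) * ∑ x, f μ x * (w (x + unitVec (fine (n + 1) M) μ) - w x) := by
        simp only [key]
    _ = ∑ μ, ∑ x, f μ x * grad n M w μ x := by
        simp only [grad, Finset.mul_sum]
        exact Finset.sum_congr rfl fun μ _ => Finset.sum_congr rfl fun x _ => by ring

/-- `Σ_μ ‖∇^η_μ w‖² ≤ 2 ⟨w, Hw⟩`, `H = torusOp n M a = −Δ^η + aQ*Q` (`a ≥ 0`, periods `≥ 3`; the `2` because
the sibling's bond sum lists each bond in both orientations and we keep only the forward one). [folklore] -/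
theorem gradSq_le_two_form (h3 : ∀ μ, 3 ≤ fine (n + 1) M μ) {a : ℝ} (ha : 0 ≤ a)
    (w : Tor (fine (n + 1) M) → ℝ) :
    ∑ μ, ∑ x, grad n M w μ x ^ 2 ≤ 2 * (w ⬝ᵥ (torusOp n M a).mulVec w) := by
  classical
  have h1 := gradSq_le_form (coupling (fine (n + 1) M) (((n : ℝ) + 1) ^ 2)) (coupling_symm _ _)
    (fun b => a / ((univ.filter fun i => B5Blocks16.blockOf (n + 1) M i = b).card : ℝ))
    (fun b => div_nonneg ha (Nat.cast_nonneg _))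
    (fun b j => if B5Blocks16.blockOf (n + 1) M j = b then (1 : ℝ) else 0) (torusOp n M a)
    (fun j k => rfl) w
  have h2 : ∀ x, ∑ k, coupling (fine (n + 1) M) (((n : ℝ) + 1) ^ 2) x k * (w x - w k) ^ 2 =
      ((n : ℝ) + 1) ^ 2 * ∑ μ : Fin d,
        ((w x - w (x + unitVec (fine (n + 1) M) μ)) ^ 2 + (w x - w (x - unitVec (fine (n + 1) M) μ)) ^ 2) :=
    fun x => sum_coupling_mul (fine (n + 1) M) h3 _ (fun k => (w x - w k) ^ 2) x
  calc ∑ μ, ∑ x, grad n M w μ x ^ 2 = ∑ x, ∑ μ, grad n M w μ x ^ 2 := Finset.sum_comm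
    _ ≤ ∑ x, ((n : ℝ) + 1) ^ 2 * ∑ μ : Fin d,
          ((w x - w (x + unitVec (fine (n + 1) M) μ)) ^ 2 + (w x - w (x - unitVec (fine (n + 1) M) μ)) ^ 2) := by
        refine Finset.sum_le_sum fun x _ => ?_
        rw [Finset.mul_sum]
        refine Finset.sum_le_sum fun μ _ => ?_
        simp only [grad]
        rw [mul_pow]
        refine mul_le_mul_of_nonneg_left ?_ (sq_nonneg _)
        rw [show (w (x + unitVec (fine (n + 1) M) μ) - w x) ^ 2 = (w x - w (x + unitVec (fine (n + 1) M) μ)) ^ 2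
          by ring]
        exact le_add_of_nonneg_right (sq_nonneg _)
    _ = ∑ x, ∑ k, coupling (fine (n + 1) M) (((n : ℝ) + 1) ^ 2) x k * (w x - w k) ^ 2 :=
        Finset.sum_congr rfl fun x _ => (h2 x).symm
    _ ≤ 2 * (w ⬝ᵥ (torusOp n M a).mulVec w) := by linarith [h1]

/-- `G₀` is symmetric: `⟨v, G₀ h⟩ = ⟨h, G₀ v⟩`. [folklore] -/
theorem dotProduct_G0_mulVec_comm (a : ℝ) (v h : Tor (fine (n + 1) M) → ℝ) :
    v ⬝ᵥ (G0 n M a).mulVec h = h ⬝ᵥ (G0 n M a).mulVec v := by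
  rw [Matrix.dotProduct_mulVec, ← Matrix.mulVec_transpose, G0_transpose, dotProduct_comm]

/-- `edist` is symmetric. [folklore] -/
theorem edist_symm (x y : Tor (fine (n + 1) M)) : edist n M x y = edist n M y x := by
  simp [TorusG0Decay.edist, ldist_symm]

/-- `edist` obeys the triangle inequality. [folklore] -/
theorem edist_triangle (x y z : Tor (fine (n + 1) M)) : edist n M x z ≤ edist n M x y + edist n M y z := by
  simp only [TorusG0Decay.edist]; rw [← mul_add]
  exact mul_le_mul_of_nonneg_left (ldist_triangle _ x y z) (by positivity)

/-- `edist x x = 0`. [folklore] -/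
theorem edist_self (x : Tor (fine (n + 1) M)) : edist n M x x = 0 := by
  simp [TorusG0Decay.edist, ldist_self]

/-- `0 ≤ edist`. [folklore] -/
theorem edist_nonneg (x y : Tor (fine (n + 1) M)) : 0 ≤ edist n M x y := by
  have h := edist_triangle n M x y x
  rw [edist_self, edist_symm n M y x] at h
  linarith

/-- a bond has `edist`-length `≤ η = 1/(n+1)` (periods `≥ 2`). [folklore] -/
theorem edist_step_le (h2 : ∀ μ, 2 ≤ fine (n + 1) M μ) (x : Tor (fine (n + 1) M)) (μ : Fin d) :
    edist n M x (x + unitVec (fine (n + 1) M) μ) ≤ 1 / ((n : ℝ) + 1) := by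
  have hadj : TorusG0Decay.Adj (fine (n + 1) M) x (x + unitVec (fine (n + 1) M) μ) := ⟨μ, Or.inl rfl⟩
  simp only [TorusG0Decay.edist]
  calc 1 / ((n : ℝ) + 1) * ldist (fine (n + 1) M) x (x + unitVec (fine (n + 1) M) μ)
      ≤ 1 / ((n : ℝ) + 1) * 1 := mul_le_mul_of_nonneg_left (ldist_le_one_of_adj _ h2 hadj) (by positivity)
    _ = 1 / ((n : ℝ) + 1) := mul_one _

/-- the Combes–Thomas weight on the torus: `twt δ T x = δ · dist_e(x, T)`. [folklore] -/
def twt (δ : ℝ) (T : Finset (Tor (fine (n + 1) M))) (hT : T.Nonempty) (x : Tor (fine (n + 1) M)) : ℝ :=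
  δ * distTo (edist n M) T hT x

/-- the weight vanishes on `T`. [folklore] -/
theorem twt_of_mem (δ : ℝ) (T : Finset (Tor (fine (n + 1) M))) (hT : T.Nonempty)
    {x : Tor (fine (n + 1) M)} (hx : x ∈ T) : twt n M δ T hT x = 0 := by
  have h0 : distTo (edist n M) T hT x = 0 :=
    le_antisymm (distTo_le_zero_of_mem (edist n M) (edist_self n M) T hT hx)
      (le_distTo (edist n M) T hT fun t _ => edist_nonneg n M x t)
  simp [twt, h0]

/-- the weight is `δ`-Lipschitz for `edist`. [folklore] -/
theorem abs_twt_sub_le {δ : ℝ} (hδ0 : 0 ≤ δ) (T : Finset (Tor (fine (n + 1) M))) (hT : T.Nonempty)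
    (x y : Tor (fine (n + 1) M)) : |twt n M δ T hT x - twt n M δ T hT y| ≤ δ * edist n M x y := by
  simp only [twt]
  rw [← mul_sub, abs_mul, abs_of_nonneg hδ0]
  exact mul_le_mul_of_nonneg_left (abs_distTo_sub_le (edist n M) (edist_symm n M) (edist_triangle n M) T hT x y) hδ0

/-- `δR ≤ twt` on a set at `edist`-distance `≥ R` from `T` (`δ ≥ 0`). [folklore] -/
theorem le_twt_of_far {δ : ℝ} (hδ0 : 0 ≤ δ) (T : Finset (Tor (fine (n + 1) M))) (hT : T.Nonempty) (R : ℝ)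
    {x : Tor (fine (n + 1) M)} (hx : ∀ t ∈ T, R ≤ edist n M x t) : δ * R ≤ twt n M δ T hT x :=
  mul_le_mul_of_nonneg_left (le_distTo (edist n M) T hT hx) hδ0

/-- across a bond leaving `T` the exponential weight moves by `≤ 2δη`: for `x ∈ T`, `0 ≤ δ ≤ 1`, periods `≥ 2`,
`|e^{twt(x+e_μ)} − 1| ≤ 2δ/(n+1)`. [folklore] -/
theorem abs_exp_twt_step_sub_one_le (h2 : ∀ μ, 2 ≤ fine (n + 1) M μ) {δ : ℝ} (hδ0 : 0 ≤ δ) (hδ1 : δ ≤ 1)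
    (T : Finset (Tor (fine (n + 1) M))) (hT : T.Nonempty) {x : Tor (fine (n + 1) M)} (hx : x ∈ T) (μ : Fin d) :
    |Real.exp (twt n M δ T hT (x + unitVec (fine (n + 1) M) μ)) - 1| ≤ 2 * (δ * (1 / ((n : ℝ) + 1))) := by
  have hη1 : 1 / ((n : ℝ) + 1) ≤ 1 := by
    rw [div_le_one (by positivity)]; linarith [(Nat.cast_nonneg n : (0 : ℝ) ≤ n)]
  have h1 : |twt n M δ T hT (x + unitVec (fine (n + 1) M) μ)| ≤ δ * (1 / ((n : ℝ) + 1)) := by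
    have h := abs_twt_sub_le n M hδ0 T hT (x + unitVec (fine (n + 1) M) μ) x
    rw [twt_of_mem n M δ T hT hx, sub_zero, edist_symm] at h
    exact h.trans (mul_le_mul_of_nonneg_left (edist_step_le n M h2 x μ) hδ0)
  have h1' : |twt n M δ T hT (x + unitVec (fine (n + 1) M) μ)| ≤ 1 :=
    h1.trans ((mul_le_mul hδ1 hη1 (by positivity) zero_le_one).trans (by norm_num))
  calc |Real.exp (twt n M δ T hT (x + unitVec (fine (n + 1) M) μ)) - 1|
      ≤ 2 * |twt n M δ T hT (x + unitVec (fine (n + 1) M) μ)| := Real.abs_exp_sub_one_le h1'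
    _ ≤ 2 * (δ * (1 / ((n : ℝ) + 1))) := by linarith

/-- **the conjugation defect of `twt` for `H = torusOp n M a`**: periods `≥ 3`, `a > 0`, `0 ≤ δ ≤ 1` ⇒
`−(2dδ² + a(e^δ − 1))‖w‖² ≤ Σ_{j,k}(e^{twt_j − twt_k} − 1) H_jk w_j w_k` (the instantiation of
`defect_ge_lattice_dist`: `η = 1/(n+1)`, `z = 2d`, blocks = the `Q`-blocks of `edist`-diameter `≤ 1`, strengths
`a`). [cite: CombesThomas1973, §II] [folklore] -/
theorem torusOp_defect_ge (h3 : ∀ μ, 3 ≤ fine (n + 1) M μ) {a δ : ℝ} (ha : 0 < a) (hδ0 : 0 ≤ δ) (hδ1 : δ ≤ 1)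
    (T : Finset (Tor (fine (n + 1) M))) (hT : T.Nonempty) (w : Tor (fine (n + 1) M) → ℝ) :
    -(2 * (d : ℝ) * δ ^ 2 + a * (Real.exp δ - 1)) * (w ⬝ᵥ w)
      ≤ ∑ j, ∑ k, (Real.exp (twt n M δ T hT j - twt n M δ T hT k) - 1) * torusOp n M a j k * (w j * w k) := by
  classical
  have h2 : ∀ μ, 2 ≤ fine (n + 1) M μ := fun μ => (by norm_num : 2 ≤ 3).trans (h3 μ)
  have hn1 : (0 : ℝ) < (n : ℝ) + 1 := by positivity
  have hγ0 : (0 : ℝ) < ((n : ℝ) + 1) ^ 2 := by positivity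
  have hη : (0 : ℝ) < 1 / ((n : ℝ) + 1) := by positivity
  have hη1 : 1 / ((n : ℝ) + 1) ≤ 1 := by rw [div_le_one hn1]; linarith
  have h := defect_ge_lattice_dist (coupling (fine (n + 1) M) (((n : ℝ) + 1) ^ 2)) (coupling_symm _ _)
    (coupling_nonneg _ hγ0.le)
    (B5Blocks16.blockOf (n + 1) M)
    (fun b => a / ((univ.filter fun i => B5Blocks16.blockOf (n + 1) M i = b).card : ℝ))
    (fun b => div_nonneg ha.le (Nat.cast_nonneg _))
    (fun b j => if B5Blocks16.blockOf (n + 1) M j = b then (1 : ℝ) else 0) (fun b j hj => if_neg hj)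
    (torusOp n M a) (fun j k => rfl) (edist n M) (edist_symm n M) (edist_triangle n M)
    (η := 1 / ((n : ℝ) + 1)) (δ := δ) (z := 2 * d) (a := a) (D := 1) hη hδ0
    (by
      calc δ * (1 / ((n : ℝ) + 1)) ≤ 1 * 1 := mul_le_mul hδ1 hη1 hη.le zero_le_one
        _ = 1 := one_mul 1)
    zero_le_one
    (fun j k hjk => by
      obtain ⟨hadj, hval⟩ := adj_of_coupling_ne_zero _ hjk
      refine ⟨?_, ?_⟩
      · rw [hval]; field_simp
      · show (1 / ((n : ℝ) + 1)) * ldist (fine (n + 1) M) j k ≤ 1 / ((n : ℝ) + 1)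
        calc (1 / ((n : ℝ) + 1)) * ldist (fine (n + 1) M) j k ≤ (1 / ((n : ℝ) + 1)) * 1 :=
              mul_le_mul_of_nonneg_left (ldist_le_one_of_adj _ h2 hadj) hη.le
          _ = 1 / ((n : ℝ) + 1) := mul_one _)
    (fun j => card_coupling_ne_zero_le _ _ j)
    (fun j k hjk => by
      show (1 / ((n : ℝ) + 1)) * ldist (fine (n + 1) M) j k ≤ 1
      calc (1 / ((n : ℝ) + 1)) * ldist (fine (n + 1) M) j k ≤ (1 / ((n : ℝ) + 1)) * n :=
            mul_le_mul_of_nonneg_left (ldist_le_of_same_block n M hjk) hη.le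
        _ ≤ 1 := by rw [div_mul_eq_mul_div, one_mul, div_le_one hn1]; linarith)
    (fun b => by rw [sum_blockInd_sq, div_mul_cancel₀ a (card_block_ne_zero n M b)])
    T hT w
  simpa only [twt, mul_one] using h

/-- the defect bound in the form consumed by `energy_le_of_pairing` / `combesThomas_form_op`: under the smallness
`2dδ² + a(e^δ − 1) ≤ min(2,a)/2`, `−(min(2,a)/2)‖w‖² ≤ defect`. [folklore] -/
theorem torusOp_herr (h3 : ∀ μ, 3 ≤ fine (n + 1) M μ) {a δ : ℝ} (ha : 0 < a) (hδ0 : 0 ≤ δ) (hδ1 : δ ≤ 1)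
    (hsmall : 2 * (d : ℝ) * δ ^ 2 + a * (Real.exp δ - 1) ≤ min 2 a / 2)
    (T : Finset (Tor (fine (n + 1) M))) (hT : T.Nonempty) (w : Tor (fine (n + 1) M) → ℝ) :
    -(min 2 a / 2) * (w ⬝ᵥ w)
      ≤ ∑ j, ∑ k, (Real.exp (twt n M δ T hT j - twt n M δ T hT k) - 1) * torusOp n M a j k * (w j * w k) := by
  have h := torusOp_defect_ge n M h3 ha hδ0 hδ1 T hT w
  have hww : 0 ≤ w ⬝ᵥ w := Finset.sum_nonneg fun j _ => mul_self_nonneg _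
  nlinarith

/-! ## §3  `G₀∇^{η*}` by duality -/

/-- sums of an `S`-truncated function. [folklore] -/
theorem sum_ite_mem_eq (S : Finset (Tor (fine (n + 1) M))) (G : Tor (fine (n + 1) M) → ℝ) :
    ∑ x, (if x ∈ S then G x else 0) = ∑ x ∈ S, G x := by
  classical
  rw [← Finset.sum_filter]
  congr 1
  ext x
  simp

/-- **`L²` set-to-set decay of `G₀∇^{η*}`.**  Periods `≥ 3`, `a > 0`, `0 ≤ δ ≤ 1`, `2dδ² + a(e^δ − 1) ≤ min(2,a)/2`;
`f = (f_μ)` supported in `T`, `edist(S,T) ≥ R`: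
`Σ_{x∈S} (G₀∇^{η*}f)(x)² ≤ (32/min(2,a)) e^{−2δR} Σ_μ Σ_x f_μ(x)²`.  Proof by duality: with `u = G₀∇^{η*}f` and
`h = 1_S u`, `Σ_{x∈S} u² = ⟨∇^{η*}f, G₀h⟩ = Σ_μ⟨f_μ, ∇^η_μ G₀h⟩ ≤ ‖f‖ · ‖∇^η G₀ h‖_{ℓ²(T)}` and the sibling's
`G0_gradDecay` (source `h` in `S`, gradient measured on `T`). [cite: CombesThomas1973, §II] [folklore] -/
theorem G0_dive_setDecay (h3 : ∀ μ, 3 ≤ fine (n + 1) M μ) {a δ : ℝ} (ha : 0 < a) (hδ0 : 0 ≤ δ) (hδ1 : δ ≤ 1)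
    (hsmall : 2 * (d : ℝ) * δ ^ 2 + a * (Real.exp δ - 1) ≤ min 2 a / 2)
    (S T : Finset (Tor (fine (n + 1) M))) (R : ℝ) (hR : ∀ x ∈ S, ∀ t ∈ T, R ≤ edist n M x t)
    (f : Fin d → Tor (fine (n + 1) M) → ℝ) (hf : ∀ μ x, x ∉ T → f μ x = 0) :
    ∑ x ∈ S, (G0 n M a).mulVec (dive n M f) x ^ 2
      ≤ 32 / min 2 a * Real.exp (-(2 * (δ * R))) * ∑ μ, ∑ x, f μ x ^ 2 := by
  classical
  have hσ : 0 < min 2 a := lt_min two_pos ha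
  have hF0 : 0 ≤ ∑ μ, ∑ x, f μ x ^ 2 := Finset.sum_nonneg fun μ _ => Finset.sum_nonneg fun x _ => sq_nonneg _
  rcases S.eq_empty_or_nonempty with hS | hS
  · rw [hS, Finset.sum_empty]; positivity
  set u : Tor (fine (n + 1) M) → ℝ := (G0 n M a).mulVec (dive n M f) with hu
  set h : Tor (fine (n + 1) M) → ℝ := fun x => if x ∈ S then u x else 0 with hh
  set A : ℝ := ∑ x ∈ S, u x ^ 2 with hA
  set F : ℝ := ∑ μ, ∑ x, f μ x ^ 2 with hF
  set K : ℝ := 32 / min 2 a * Real.exp (-(2 * (δ * R))) with hK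
  have hA0 : 0 ≤ A := Finset.sum_nonneg fun x _ => sq_nonneg _
  have hK0 : 0 ≤ K := by positivity
  -- (1) `A = ⟨u, h⟩` and `‖h‖² = A`
  have h1 : u ⬝ᵥ h = A := by
    simp only [dotProduct, hh, mul_ite, mul_zero]
    rw [sum_ite_mem_eq]
    exact Finset.sum_congr rfl fun x _ => by ring
  have h2 : ∑ x, h x ^ 2 = A := by
    simp only [hh, ite_pow, zero_pow two_ne_zero]
    rw [sum_ite_mem_eq]
  -- (2) duality and summation by parts
  have h3' : u ⬝ᵥ h = ∑ μ, ∑ x, f μ x * grad n M ((G0 n M a).mulVec h) μ x := by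
    rw [hu, dotProduct_comm, dotProduct_G0_mulVec_comm, dotProduct_comm]
    exact dive_adjoint n M ((G0 n M a).mulVec h) f
  have h4 : ∑ μ, ∑ x, f μ x * grad n M ((G0 n M a).mulVec h) μ x =
      ∑ μ, ∑ x ∈ T, f μ x * grad n M ((G0 n M a).mulVec h) μ x := by
    refine Finset.sum_congr rfl fun μ _ => (Finset.sum_subset (Finset.subset_univ T) fun x _ hx => ?_).symm
    rw [hf μ x hx, zero_mul]
  -- (3) Cauchy–Schwarz over `Fin d × T`
  have hCS : (∑ μ, ∑ x ∈ T, f μ x * grad n M ((G0 n M a).mulVec h) μ x) ^ 2 ≤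
      (∑ μ, ∑ x ∈ T, f μ x ^ 2) * ∑ μ, ∑ x ∈ T, grad n M ((G0 n M a).mulVec h) μ x ^ 2 := by
    simpa only [Finset.sum_product] using
      Finset.sum_mul_sq_le_sq_mul_sq (univ ×ˢ T) (fun p => f p.1 p.2)
        (fun p => grad n M ((G0 n M a).mulVec h) p.1 p.2)
  -- (4) the sibling's gradient decay, source `h` in `S`, gradient on `T`
  have h5 : ∑ μ, ∑ x ∈ T, grad n M ((G0 n M a).mulVec h) μ x ^ 2 ≤ K * A := by
    have hdec := G0_gradDecay n M h3 ha hδ0 hδ1 hsmall T S hS R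
      (fun t ht x hx => by rw [edist_symm]; exact hR x hx t ht) h
      (fun x hx => by simp only [hh]; rw [if_neg hx])
    rw [h2] at hdec
    calc ∑ μ, ∑ x ∈ T, grad n M ((G0 n M a).mulVec h) μ x ^ 2
        = ∑ x ∈ T, ∑ μ, grad n M ((G0 n M a).mulVec h) μ x ^ 2 := Finset.sum_comm
      _ ≤ ∑ x ∈ T, ((n : ℝ) + 1) ^ 2 * ∑ μ : Fin d,
            (((G0 n M a).mulVec h x - (G0 n M a).mulVec h (x + unitVec (fine (n + 1) M) μ)) ^ 2
              + ((G0 n M a).mulVec h x - (G0 n M a).mulVec h (x - unitVec (fine (n + 1) M) μ)) ^ 2) := by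
          refine Finset.sum_le_sum fun x _ => ?_
          rw [Finset.mul_sum]
          refine Finset.sum_le_sum fun μ _ => ?_
          simp only [grad]
          rw [mul_pow]
          refine mul_le_mul_of_nonneg_left ?_ (sq_nonneg _)
          rw [show ((G0 n M a).mulVec h (x + unitVec (fine (n + 1) M) μ) - (G0 n M a).mulVec h x) ^ 2 =
              ((G0 n M a).mulVec h x - (G0 n M a).mulVec h (x + unitVec (fine (n + 1) M) μ)) ^ 2 by ring]
          exact le_add_of_nonneg_right (sq_nonneg _)
      _ ≤ K * A := hdec
  -- (5) `A² ≤ F · K · A`, hence `A ≤ K F`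
  have hFT : ∑ μ, ∑ x ∈ T, f μ x ^ 2 ≤ F :=
    Finset.sum_le_sum fun μ _ =>
      Finset.sum_le_sum_of_subset_of_nonneg (Finset.subset_univ T) fun x _ _ => sq_nonneg _
  have hmain : A ^ 2 ≤ F * (K * A) := by
    have e : A = ∑ μ, ∑ x ∈ T, f μ x * grad n M ((G0 n M a).mulVec h) μ x := by rw [← h4, ← h3', h1]
    calc A ^ 2 = (∑ μ, ∑ x ∈ T, f μ x * grad n M ((G0 n M a).mulVec h) μ x) ^ 2 := by rw [← e]
      _ ≤ (∑ μ, ∑ x ∈ T, f μ x ^ 2) * ∑ μ, ∑ x ∈ T, grad n M ((G0 n M a).mulVec h) μ x ^ 2 := hCS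
      _ ≤ F * (K * A) :=
          mul_le_mul hFT h5 (Finset.sum_nonneg fun μ _ => Finset.sum_nonneg fun x _ => sq_nonneg _)
            (hFT.trans' (Finset.sum_nonneg fun μ _ => Finset.sum_nonneg fun x _ => sq_nonneg _))
  show A ≤ K * F
  by_contra hlt
  have hlt' : K * F < A := not_le.mp hlt
  have hApos : 0 < A := lt_of_le_of_lt (by positivity) hlt'
  nlinarith [hmain, hlt', hApos, hK0, hF0, mul_nonneg hK0 hF0]

/-- **`‖G₀∇^{η*}‖_{ℓ²→ℓ²} ≤ √(32/min(2,a))` uniformly in the mesh**: `Σ_x (G₀∇^{η*}f)(x)² ≤ (32/min(2,a)) Σ_μΣ_x f_μ(x)²`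
for every `f` (`δ = 0`, `S = T = univ`). [folklore] -/
theorem G0_dive_sq_le (h3 : ∀ μ, 3 ≤ fine (n + 1) M μ) {a : ℝ} (ha : 0 < a)
    (f : Fin d → Tor (fine (n + 1) M) → ℝ) :
    ∑ x, (G0 n M a).mulVec (dive n M f) x ^ 2 ≤ 32 / min 2 a * ∑ μ, ∑ x, f μ x ^ 2 := by
  have h := G0_dive_setDecay n M h3 ha le_rfl zero_le_one (by have h0 : (0 : ℝ) < min 2 a := lt_min two_pos ha; norm_num; linarith) univ univ 0
    (fun x _ t _ => edist_nonneg n M x t) f (fun μ x hx => absurd (Finset.mem_univ x) hx)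
  simpa using h

/-! ## §4  The weighted energy of `G₀∇^{η*}f` -/

/-- **weighted energy bound for a divergence source.**  Periods `≥ 3`, `a > 0`, `0 ≤ δ ≤ 1`,
`2dδ² + a(e^δ − 1) ≤ min(2,a)/2`, `f` supported in `T ≠ ∅`, `v = G₀∇^{η*}f`, `w = e^{twt}v` (`twt = δ·dist_e(·,T)`):
`⟨w, Hw⟩ ≤ 24 Σ_μΣ_x f_μ(x)²`.  (Weighted summation by parts: the pairing is `Σ_μΣ_{x∈T} f_μ(x)·∇^η_μ(e^{twt}w)(x)`
and on `T` the weight is `1` while `|e^{twt(x+e_μ)} − 1| ≤ 2δη`, so `∇^η_μ(e^{twt}w) = ∇^η_μ w + D` with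
`|D| ≤ 2δ|w(x+e_μ)|`; AM–GM, `Σ‖∇^η_μ w‖² ≤ 2⟨w,Hw⟩`, `Σ_μ‖w(·+e_μ)‖² = d‖w‖²`, `4dδ² ≤ min(2,a) ≤ ⟨w,Hw⟩/‖w‖²`
give pairing `≤ ¼⟨w,Hw⟩ + 6‖f‖²`, and `energy_le_of_pairing` concludes.) [cite: CombesThomas1973, §II] [folklore] -/
theorem G0_dive_energy (h3 : ∀ μ, 3 ≤ fine (n + 1) M μ) {a δ : ℝ} (ha : 0 < a) (hδ0 : 0 ≤ δ) (hδ1 : δ ≤ 1)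
    (hsmall : 2 * (d : ℝ) * δ ^ 2 + a * (Real.exp δ - 1) ≤ min 2 a / 2)
    (T : Finset (Tor (fine (n + 1) M))) (hT : T.Nonempty)
    (f : Fin d → Tor (fine (n + 1) M) → ℝ) (hf : ∀ μ x, x ∉ T → f μ x = 0) :
    (fun x => Real.exp (twt n M δ T hT x) * (G0 n M a).mulVec (dive n M f) x)
        ⬝ᵥ (torusOp n M a).mulVec (fun x => Real.exp (twt n M δ T hT x) * (G0 n M a).mulVec (dive n M f) x)
      ≤ 24 * ∑ μ, ∑ x, f μ x ^ 2 := by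
  classical
  have h2 : ∀ μ, 2 ≤ fine (n + 1) M μ := fun μ => (by norm_num : 2 ≤ 3).trans (h3 μ)
  have hn1 : (0 : ℝ) < (n : ℝ) + 1 := by positivity
  have hσ : 0 < min 2 a := lt_min two_pos ha
  set v : Tor (fine (n + 1) M) → ℝ := (G0 n M a).mulVec (dive n M f) with hv_def
  have hv : (torusOp n M a).mulVec v = dive n M f := torusOp_mulVec_G0 n M h3 ha _
  set w : Tor (fine (n + 1) M) → ℝ := fun x => Real.exp (twt n M δ T hT x) * v x with hw
  set F : ℝ := ∑ μ, ∑ x, f μ x ^ 2 with hF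
  have hcoer := coercive_torus n M h3 ha.le
  have herr := torusOp_herr n M h3 ha hδ0 hδ1 hsmall T hT
  -- `4dδ² ≤ min(2,a)`
  have h4d : 4 * ((d : ℝ) * δ ^ 2) ≤ min 2 a := by
    have : 0 ≤ a * (Real.exp δ - 1) := mul_nonneg ha.le (by linarith [Real.add_one_le_exp δ])
    linarith
  -- the pairing bound
  have hpair : ∑ x, (Real.exp (twt n M δ T hT x) * v x) * (Real.exp (twt n M δ T hT x) * (torusOp n M a).mulVec v x)
      ≤ 1 / 4 * (w ⬝ᵥ (torusOp n M a).mulVec w) + 6 * F := by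
    rw [hv]
    have e1 : ∑ x, (Real.exp (twt n M δ T hT x) * v x) * (Real.exp (twt n M δ T hT x) * dive n M f x)
        = ∑ x, (Real.exp (twt n M δ T hT x) * w x) * dive n M f x :=
      Finset.sum_congr rfl fun x _ => by simp only [hw]; ring
    rw [e1, dive_adjoint]
    have e2 : ∑ μ, ∑ x, f μ x * grad n M (fun x => Real.exp (twt n M δ T hT x) * w x) μ x
        = ∑ μ, ∑ x ∈ T, f μ x * grad n M (fun x => Real.exp (twt n M δ T hT x) * w x) μ x := by
      refine Finset.sum_congr rfl fun μ _ => (Finset.sum_subset (Finset.subset_univ T) fun x _ hx => ?_).symm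
      rw [hf μ x hx, zero_mul]
    rw [e2]
    -- termwise AM–GM on `T`
    have hterm : ∀ μ, ∀ x ∈ T, f μ x * grad n M (fun y => Real.exp (twt n M δ T hT y) * w y) μ x
        ≤ 1 / 16 * grad n M w μ x ^ 2 + 1 / 2 * (δ ^ 2 * w (x + unitVec (fine (n + 1) M) μ) ^ 2)
          + 6 * f μ x ^ 2 := by
      intro μ x hx
      have hx0 : twt n M δ T hT x = 0 := twt_of_mem n M δ T hT hx
      have hsplit : grad n M (fun y => Real.exp (twt n M δ T hT y) * w y) μ x
          = grad n M w μ x + ((n : ℝ) + 1) * ((Real.exp (twt n M δ T hT (x + unitVec (fine (n + 1) M) μ)) - 1)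
              * w (x + unitVec (fine (n + 1) M) μ)) := by
        simp only [grad, hx0, Real.exp_zero, one_mul]
        ring
      have hstep := abs_exp_twt_step_sub_one_le n M h2 hδ0 hδ1 T hT hx μ
      have hDabs : |((n : ℝ) + 1) * ((Real.exp (twt n M δ T hT (x + unitVec (fine (n + 1) M) μ)) - 1)
          * w (x + unitVec (fine (n + 1) M) μ))| ≤ 2 * δ * |w (x + unitVec (fine (n + 1) M) μ)| := by
        rw [abs_mul, abs_mul, abs_of_pos hn1]
        calc ((n : ℝ) + 1) * (|Real.exp (twt n M δ T hT (x + unitVec (fine (n + 1) M) μ)) - 1|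
                * |w (x + unitVec (fine (n + 1) M) μ)|)
            ≤ ((n : ℝ) + 1) * ((2 * (δ * (1 / ((n : ℝ) + 1)))) * |w (x + unitVec (fine (n + 1) M) μ)|) :=
              mul_le_mul_of_nonneg_left (mul_le_mul_of_nonneg_right hstep (abs_nonneg _)) hn1.le
          _ = 2 * δ * |w (x + unitVec (fine (n + 1) M) μ)| := by field_simp
      have hDsq : (((n : ℝ) + 1) * ((Real.exp (twt n M δ T hT (x + unitVec (fine (n + 1) M) μ)) - 1)
          * w (x + unitVec (fine (n + 1) M) μ))) ^ 2 ≤ 4 * (δ ^ 2 * w (x + unitVec (fine (n + 1) M) μ) ^ 2) := by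
        calc (((n : ℝ) + 1) * ((Real.exp (twt n M δ T hT (x + unitVec (fine (n + 1) M) μ)) - 1)
              * w (x + unitVec (fine (n + 1) M) μ))) ^ 2
            = |((n : ℝ) + 1) * ((Real.exp (twt n M δ T hT (x + unitVec (fine (n + 1) M) μ)) - 1)
              * w (x + unitVec (fine (n + 1) M) μ))| ^ 2 := (sq_abs _).symm
          _ ≤ (2 * δ * |w (x + unitVec (fine (n + 1) M) μ)|) ^ 2 := pow_le_pow_left₀ (abs_nonneg _) hDabs 2
          _ = 4 * (δ ^ 2 * w (x + unitVec (fine (n + 1) M) μ) ^ 2) := by rw [mul_pow, mul_pow, sq_abs]; ring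
      rw [hsplit, mul_add]
      have i1 : f μ x * grad n M w μ x ≤ 1 / 16 * grad n M w μ x ^ 2 + 4 * f μ x ^ 2 := by
        nlinarith [sq_nonneg (grad n M w μ x - 8 * f μ x)]
      have i2 : f μ x * (((n : ℝ) + 1) * ((Real.exp (twt n M δ T hT (x + unitVec (fine (n + 1) M) μ)) - 1)
          * w (x + unitVec (fine (n + 1) M) μ)))
          ≤ 1 / 8 * (((n : ℝ) + 1) * ((Real.exp (twt n M δ T hT (x + unitVec (fine (n + 1) M) μ)) - 1)
              * w (x + unitVec (fine (n + 1) M) μ))) ^ 2 + 2 * f μ x ^ 2 := by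
        nlinarith [sq_nonneg (((n : ℝ) + 1) * ((Real.exp (twt n M δ T hT (x + unitVec (fine (n + 1) M) μ)) - 1)
          * w (x + unitVec (fine (n + 1) M) μ)) - 4 * f μ x)]
      linarith [i1, i2, hDsq]
    -- sum the termwise bound and extend from `T` to all sites
    have hsumT : ∑ μ, ∑ x ∈ T, f μ x * grad n M (fun x => Real.exp (twt n M δ T hT x) * w x) μ x
        ≤ ∑ μ, ∑ x, (1 / 16 * grad n M w μ x ^ 2 + 1 / 2 * (δ ^ 2 * w (x + unitVec (fine (n + 1) M) μ) ^ 2)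
            + 6 * f μ x ^ 2) := by
      calc ∑ μ, ∑ x ∈ T, f μ x * grad n M (fun x => Real.exp (twt n M δ T hT x) * w x) μ x
          ≤ ∑ μ, ∑ x ∈ T, (1 / 16 * grad n M w μ x ^ 2 + 1 / 2 * (δ ^ 2 * w (x + unitVec (fine (n + 1) M) μ) ^ 2)
              + 6 * f μ x ^ 2) := Finset.sum_le_sum fun μ _ => Finset.sum_le_sum fun x hx => hterm μ x hx
        _ ≤ _ := Finset.sum_le_sum fun μ _ =>
              Finset.sum_le_sum_of_subset_of_nonneg (Finset.subset_univ T) fun x _ _ => by positivity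
    have hsplit_sum : ∑ μ, ∑ x, (1 / 16 * grad n M w μ x ^ 2
        + 1 / 2 * (δ ^ 2 * w (x + unitVec (fine (n + 1) M) μ) ^ 2) + 6 * f μ x ^ 2)
        = 1 / 16 * ∑ μ, ∑ x, grad n M w μ x ^ 2
          + 1 / 2 * (δ ^ 2 * ∑ μ, ∑ x, w (x + unitVec (fine (n + 1) M) μ) ^ 2) + 6 * F := by
      simp only [Finset.sum_add_distrib, ← Finset.mul_sum, hF]
    -- the three pieces
    have hG : ∑ μ, ∑ x, grad n M w μ x ^ 2 ≤ 2 * (w ⬝ᵥ (torusOp n M a).mulVec w) :=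
      gradSq_le_two_form n M h3 ha.le w
    have hW : ∑ μ, ∑ x, w (x + unitVec (fine (n + 1) M) μ) ^ 2 = (d : ℝ) * (w ⬝ᵥ w) := by
      have e : ∀ μ, ∑ x, w (x + unitVec (fine (n + 1) M) μ) ^ 2 = w ⬝ᵥ w := fun μ => by
        rw [sum_shift (fine (n + 1) M) (unitVec (fine (n + 1) M) μ) (fun x => w x ^ 2)]
        simp only [dotProduct]
        exact Finset.sum_congr rfl fun x _ => by ring
      simp only [e, Finset.sum_const, Finset.card_univ, Fintype.card_fin, nsmul_eq_mul]
    have hS0 : 0 ≤ w ⬝ᵥ w := Finset.sum_nonneg fun j _ => mul_self_nonneg _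
    have hSE : min 2 a * (w ⬝ᵥ w) ≤ w ⬝ᵥ (torusOp n M a).mulVec w := hcoer w
    have hdS : δ ^ 2 * ((d : ℝ) * (w ⬝ᵥ w)) ≤ 1 / 4 * (w ⬝ᵥ (torusOp n M a).mulVec w) := by
      have := mul_le_mul_of_nonneg_right h4d hS0
      nlinarith
    calc ∑ μ, ∑ x ∈ T, f μ x * grad n M (fun x => Real.exp (twt n M δ T hT x) * w x) μ x
        ≤ 1 / 16 * ∑ μ, ∑ x, grad n M w μ x ^ 2
          + 1 / 2 * (δ ^ 2 * ∑ μ, ∑ x, w (x + unitVec (fine (n + 1) M) μ) ^ 2) + 6 * F := by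
          rw [← hsplit_sum]; exact hsumT
      _ ≤ 1 / 16 * (2 * (w ⬝ᵥ (torusOp n M a).mulVec w))
          + 1 / 2 * (1 / 4 * (w ⬝ᵥ (torusOp n M a).mulVec w)) + 6 * F := by
          rw [hW]
          exact add_le_add (add_le_add (mul_le_mul_of_nonneg_left hG (by norm_num))
            (mul_le_mul_of_nonneg_left hdS (by norm_num))) le_rfl
      _ = 1 / 4 * (w ⬝ᵥ (torusOp n M a).mulVec w) + 6 * F := by ring
  have hE := energy_le_of_pairing (torusOp n M a) (min 2 a) (twt n M δ T hT) hcoer herr v (6 * F) hpair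
  linarith

/-! ## §5  `∇^η G₀ ∇^{η*}`: `η`-uniform set-to-set decay and `ℓ²` bound -/

/-- **`η`-uniform `L²` set-to-set decay of `∇^η G₀ ∇^{η*}`.**  Periods `≥ 3`, `a > 0`, `0 ≤ δ ≤ 1`,
`2dδ² + a(e^δ − 1) ≤ min(2,a)/2`, `f` supported in `T ≠ ∅`, `edist(S,T) ≥ R`, `u = G₀∇^{η*}f`:
`Σ_{x∈S} (n+1)² Σ_μ [(u(x) − u(x+e_μ))² + (u(x) − u(x−e_μ))²] ≤ 192 · e^{−2δR} · Σ_μΣ_x f_μ(x)²`.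
(`Σ_{x∈S}Σ_k c_xk(u_x − u_k)² ≤ e^{−2δR}[2Σc(w_j−w_k)² + 2(2δη)²(2dη⁻²)‖w‖²] ≤ e^{−2δR}·8⟨w,Hw⟩` by §1–§2 and
`16dδ² ≤ 4 min(2,a)`, then §4.) [cite: CombesThomas1973, §II] [folklore] -/
theorem G0_dive_gradDecay (h3 : ∀ μ, 3 ≤ fine (n + 1) M μ) {a δ : ℝ} (ha : 0 < a) (hδ0 : 0 ≤ δ) (hδ1 : δ ≤ 1)
    (hsmall : 2 * (d : ℝ) * δ ^ 2 + a * (Real.exp δ - 1) ≤ min 2 a / 2)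
    (S T : Finset (Tor (fine (n + 1) M))) (hT : T.Nonempty) (R : ℝ)
    (hR : ∀ x ∈ S, ∀ t ∈ T, R ≤ edist n M x t)
    (f : Fin d → Tor (fine (n + 1) M) → ℝ) (hf : ∀ μ x, x ∉ T → f μ x = 0) :
    ∑ x ∈ S, ((n : ℝ) + 1) ^ 2 * ∑ μ : Fin d,
        (((G0 n M a).mulVec (dive n M f) x - (G0 n M a).mulVec (dive n M f) (x + unitVec (fine (n + 1) M) μ)) ^ 2
          + ((G0 n M a).mulVec (dive n M f) x
              - (G0 n M a).mulVec (dive n M f) (x - unitVec (fine (n + 1) M) μ)) ^ 2)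
      ≤ 192 * Real.exp (-(2 * (δ * R))) * ∑ μ, ∑ x, f μ x ^ 2 := by
  classical
  have h2 : ∀ μ, 2 ≤ fine (n + 1) M μ := fun μ => (by norm_num : 2 ≤ 3).trans (h3 μ)
  have hn1 : (0 : ℝ) < (n : ℝ) + 1 := by positivity
  have hγ0 : (0 : ℝ) < ((n : ℝ) + 1) ^ 2 := by positivity
  have hη : (0 : ℝ) < 1 / ((n : ℝ) + 1) := by positivity
  have hη1 : 1 / ((n : ℝ) + 1) ≤ 1 := by rw [div_le_one hn1]; linarith
  have hσ : 0 < min 2 a := lt_min two_pos ha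
  set v : Tor (fine (n + 1) M) → ℝ := (G0 n M a).mulVec (dive n M f) with hv_def
  set w : Tor (fine (n + 1) M) → ℝ := fun x => Real.exp (twt n M δ T hT x) * v x with hw
  set F : ℝ := ∑ μ, ∑ x, f μ x ^ 2 with hF
  have hF0 : 0 ≤ F := Finset.sum_nonneg fun μ _ => Finset.sum_nonneg fun x _ => sq_nonneg _
  -- the energy bound of §4
  have hE : w ⬝ᵥ (torusOp n M a).mulVec w ≤ 24 * F := G0_dive_energy n M h3 ha hδ0 hδ1 hsmall T hT f hf
  have hS0 : 0 ≤ w ⬝ᵥ w := Finset.sum_nonneg fun j _ => mul_self_nonneg _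
  have hSE : min 2 a * (w ⬝ᵥ w) ≤ w ⬝ᵥ (torusOp n M a).mulVec w := coercive_torus n M h3 ha.le w
  have h4d : 4 * ((d : ℝ) * δ ^ 2) ≤ min 2 a := by
    have : 0 ≤ a * (Real.exp δ - 1) := mul_nonneg ha.le (by linarith [Real.add_one_le_exp δ])
    linarith
  -- abbreviate the coupling
  set c : Tor (fine (n + 1) M) → Tor (fine (n + 1) M) → ℝ := coupling (fine (n + 1) M) (((n : ℝ) + 1) ^ 2)
    with hc_def
  -- (1) list the neighbours
  have hL : ∀ x, ∑ k, c x k * (v x - v k) ^ 2 = ((n : ℝ) + 1) ^ 2 * ∑ μ : Fin d,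
      ((v x - v (x + unitVec (fine (n + 1) M) μ)) ^ 2 + (v x - v (x - unitVec (fine (n + 1) M) μ)) ^ 2) :=
    fun x => sum_coupling_mul (fine (n + 1) M) h3 _ (fun k => (v x - v k) ^ 2) x
  -- (2) restrict to `S`: weight `≥ δR` there
  have hset := setGradSq_le_weighted c (coupling_nonneg _ hγ0.le) (twt n M δ T hT) v S (δ * R)
    (fun x hx => le_twt_of_far n M hδ0 T hT R (hR x hx))
  -- (3) bond algebra with `ε = 2δη`, `ρ = 2d η⁻²`
  have hε : ∀ j k, c j k ≠ 0 → |Real.exp (twt n M δ T hT j - twt n M δ T hT k) - 1| ≤ 2 * (δ * (1 / ((n : ℝ) + 1))) := by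
    intro j k hjk
    obtain ⟨hadj, -⟩ := adj_of_coupling_ne_zero _ hjk
    have hb : |twt n M δ T hT j - twt n M δ T hT k| ≤ δ * (1 / ((n : ℝ) + 1)) := by
      refine (abs_twt_sub_le n M hδ0 T hT j k).trans (mul_le_mul_of_nonneg_left ?_ hδ0)
      simp only [TorusG0Decay.edist]
      calc 1 / ((n : ℝ) + 1) * ldist (fine (n + 1) M) j k ≤ 1 / ((n : ℝ) + 1) * 1 :=
            mul_le_mul_of_nonneg_left (ldist_le_one_of_adj _ h2 hadj) hη.le
        _ = 1 / ((n : ℝ) + 1) := mul_one _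
    have hb1 : |twt n M δ T hT j - twt n M δ T hT k| ≤ 1 :=
      hb.trans ((mul_le_mul hδ1 hη1 hη.le zero_le_one).trans (by norm_num))
    calc |Real.exp (twt n M δ T hT j - twt n M δ T hT k) - 1| ≤ 2 * |twt n M δ T hT j - twt n M δ T hT k| :=
          Real.abs_exp_sub_one_le hb1
      _ ≤ 2 * (δ * (1 / ((n : ℝ) + 1))) := by linarith
  have hρ : ∀ k, ∑ j, c j k ≤ 2 * (d : ℝ) * ((1 / ((n : ℝ) + 1)) ^ 2)⁻¹ := by
    intro k
    have e : ∑ j, c j k = ∑ j, c k j := Finset.sum_congr rfl fun j _ => coupling_symm _ _ j k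
    rw [e]
    refine rowSum_le c k (fun j hj => ?_) (card_coupling_ne_zero_le _ _ k)
    have hj' : coupling (fine (n + 1) M) (((n : ℝ) + 1) ^ 2) k j ≠ 0 := hj
    show coupling (fine (n + 1) M) (((n : ℝ) + 1) ^ 2) k j = _
    rw [(adj_of_coupling_ne_zero _ hj').2]; field_simp
  have halg := weightedGradSq_le_energy c (coupling_nonneg _ hγ0.le) (twt n M δ T hT) v hε hρ
  -- (4) the two pieces: `Σ c (w_j − w_k)² ≤ 2⟨w,Hw⟩` and `2ε²ρ‖w‖² = 16dδ²‖w‖² ≤ 4⟨w,Hw⟩`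
  have hgrad := gradSq_le_form c (coupling_symm _ _)
    (fun b => a / ((univ.filter fun i => B5Blocks16.blockOf (n + 1) M i = b).card : ℝ))
    (fun b => div_nonneg ha.le (Nat.cast_nonneg _))
    (fun b j => if B5Blocks16.blockOf (n + 1) M j = b then (1 : ℝ) else 0) (torusOp n M a)
    (fun j k => rfl) w
  have hww : ∑ k, (Real.exp (twt n M δ T hT k) * v k) ^ 2 = w ⬝ᵥ w := by
    simp only [dotProduct, hw]; exact Finset.sum_congr rfl fun k _ => by ring
  have hconst : 2 * (2 * (δ * (1 / ((n : ℝ) + 1)))) ^ 2 * (2 * (d : ℝ) * ((1 / ((n : ℝ) + 1)) ^ 2)⁻¹)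
      = 16 * ((d : ℝ) * δ ^ 2) := by
    field_simp
    ring
  have hweighted : ∑ j, ∑ k, c j k * (Real.exp (twt n M δ T hT j) * (v j - v k)) ^ 2
      ≤ 8 * (w ⬝ᵥ (torusOp n M a).mulVec w) := by
    have hA : ∑ j, ∑ k, c j k * (Real.exp (twt n M δ T hT j) * v j - Real.exp (twt n M δ T hT k) * v k) ^ 2
        ≤ 2 * (w ⬝ᵥ (torusOp n M a).mulVec w) := by
      have e : ∑ j, ∑ k, c j k * (Real.exp (twt n M δ T hT j) * v j - Real.exp (twt n M δ T hT k) * v k) ^ 2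
          = ∑ j, ∑ k, c j k * (w j - w k) ^ 2 := by simp only [hw]
      rw [e]; linarith [hgrad]
    have hB : 2 * (2 * (δ * (1 / ((n : ℝ) + 1)))) ^ 2 * (2 * (d : ℝ) * ((1 / ((n : ℝ) + 1)) ^ 2)⁻¹
        * ∑ k, (Real.exp (twt n M δ T hT k) * v k) ^ 2) ≤ 4 * (w ⬝ᵥ (torusOp n M a).mulVec w) := by
      rw [← mul_assoc, hconst, hww]
      have := mul_le_mul_of_nonneg_right h4d hS0
      nlinarith
    calc ∑ j, ∑ k, c j k * (Real.exp (twt n M δ T hT j) * (v j - v k)) ^ 2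
        ≤ 2 * ∑ j, ∑ k, c j k * (Real.exp (twt n M δ T hT j) * v j - Real.exp (twt n M δ T hT k) * v k) ^ 2
          + 2 * (2 * (δ * (1 / ((n : ℝ) + 1)))) ^ 2 * (2 * (d : ℝ) * ((1 / ((n : ℝ) + 1)) ^ 2)⁻¹
            * ∑ k, (Real.exp (twt n M δ T hT k) * v k) ^ 2) := halg
      _ ≤ 2 * (2 * (w ⬝ᵥ (torusOp n M a).mulVec w)) + 4 * (w ⬝ᵥ (torusOp n M a).mulVec w) :=
          add_le_add (mul_le_mul_of_nonneg_left hA (by norm_num)) hB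
      _ = 8 * (w ⬝ᵥ (torusOp n M a).mulVec w) := by ring
  -- (5) assemble
  calc ∑ x ∈ S, ((n : ℝ) + 1) ^ 2 * ∑ μ : Fin d,
          ((v x - v (x + unitVec (fine (n + 1) M) μ)) ^ 2 + (v x - v (x - unitVec (fine (n + 1) M) μ)) ^ 2)
      = ∑ x ∈ S, ∑ k, c x k * (v x - v k) ^ 2 := Finset.sum_congr rfl fun x _ => (hL x).symm
    _ ≤ Real.exp (-(2 * (δ * R))) * ∑ j, ∑ k, c j k * (Real.exp (twt n M δ T hT j) * (v j - v k)) ^ 2 := hset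
    _ ≤ Real.exp (-(2 * (δ * R))) * (8 * (24 * F)) := by
        refine mul_le_mul_of_nonneg_left (hweighted.trans ?_) (Real.exp_pos _).le
        linarith [hE]
    _ = 192 * Real.exp (-(2 * (δ * R))) * F := by ring

/-- **`∇^η G₀ ∇^{η*}` is `ℓ²`-bounded uniformly in the mesh**: for every `f`, with `u = G₀∇^{η*}f`,
`Σ_x (n+1)² Σ_μ [(u(x) − u(x+e_μ))² + (u(x) − u(x−e_μ))²] ≤ 192 Σ_μΣ_x f_μ(x)²` (`δ = 0`, `S = T = univ`).
[folklore] -/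
theorem G0_dive_grad_sq_le (h3 : ∀ μ, 3 ≤ fine (n + 1) M μ) {a : ℝ} (ha : 0 < a)
    (f : Fin d → Tor (fine (n + 1) M) → ℝ) :
    ∑ x, ((n : ℝ) + 1) ^ 2 * ∑ μ : Fin d,
        (((G0 n M a).mulVec (dive n M f) x - (G0 n M a).mulVec (dive n M f) (x + unitVec (fine (n + 1) M) μ)) ^ 2
          + ((G0 n M a).mulVec (dive n M f) x
              - (G0 n M a).mulVec (dive n M f) (x - unitVec (fine (n + 1) M) μ)) ^ 2)
      ≤ 192 * ∑ μ, ∑ x, f μ x ^ 2 := by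
  have h := G0_dive_gradDecay n M h3 ha le_rfl zero_le_one (by have h0 : (0 : ℝ) < min 2 a := lt_min two_pos ha; norm_num; linarith) univ univ
    Finset.univ_nonempty 0 (fun x _ t _ => edist_nonneg n M x t) f (fun μ x hx => absurd (Finset.mem_univ x) hx)
  simpa using h

end Torus

end

end Literature.MathematicalPhysics.QuantumFieldTheory.Balaban1983to89.Beta.TorusG0DivDecay
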